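import Summits.MatrixMultiplication.OmegaCensus.STPPSmallPatternKernelBits

/-!
# (2,1,1)⁶ in (ℤ/2)⁵ — the X-ROOM CERTIFICATE, part A: the engine

Cell `pub-omega` (unit `pub-omega-stpp-1-g35`), topic `Summits/MatrixMultiplication/OmegaCensus`.
HONEST FRAMING (verbatim): lottery ticket; floor = certified bounds/negative ranges. Census STRUCTURE bookkeeping (B5, the threshold column
`T1(H) = max {k : (2,1,1)^k ⊆ H}` at the elementary type `(ℤ/2)⁵`; the ROOM mechanism class of X-38); nothing here is a bound on `ω`.

THE ENGINE (codes `0 … 31` of `𝔽₂⁵`, addition = `Nat.xor`; kernel idioms `force` / `allBits` / `lowBit` / `hasBits` of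
`STPPSmallPatternKernelSearch` (seat pub-omega-stpp-3)). A `(2,1,1)^k` family in the translation normal form `Bᵢ = {0}`, `Cᵢ = {cᵢ}`,
`Aᵢ = {aᵢ, aᵢ'}` is STPP iff for all ordered pairs `(i, l)`: `(Aᵢ + A_l) ∩ (c_l + C) = ∅` (`i ≠ l`) and `aᵢ + aᵢ' ∉ cᵢ + C` — one instance of
the CKSU Def. 5.1 word each (the reflection file proves the direction it needs). For block `i` write `Pᵢ = cᵢ + C` and let `Tᵢ` be the
PACKED TRANSLATE TABLE of `Pᵢ` (field `a` = the 32-bit mask of `Pᵢ + a` at bit offset `32 a`; `mkTabs`). `T1Z2p5.go ts used F1` places the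
blocks whose tables are listed in `ts`, in order, as pairs `a < a'` of codes outside `used = ⋃ A_l` (placed blocks), outside the X-ROOM SET
`F1 = ⋃ₗ (P_l + A_l)` of the placed blocks and outside `⋃_{a ∈ used} (Pᵢ + a)`, with `a + a' ∉ Pᵢ`; it PRUNES a state with fewer than
`2 ·` (blocks left) codes outside `used ∪ F1` (no completion can exist), and at every COMPLETE family it checks `F1 = 2³² − 1`.
So `go (mkTabs C) 0 0 = true` says: EVERY normal-form family with `c`-code list `C` has X-room set `⋃ⱼₗ ((Bⱼ − Cⱼ) + (C_l − A_l)) = univ`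
(soundness: the reflection file). The kernel decisions on the four `C`-list representatives are separate files (`…RoomDecide*`).

References: H. Cohn, R. Kleinberg, B. Szegedy, C. Umans, FOCS 2005 (arXiv:math/0511460), Def. 5.1. Record: HOME `pub-omega-stpp-1-g35/code/`
(C twin `t1room.c`, Python twin `mirror.py`).
-/

namespace Summit.MatrixMultiplication.OmegaCensus

namespace T1Z2p5

open STPP211Neg

/-- The mask `2³² − 1` of all 32 codes of `𝔽₂⁵`. -/
def full5 : ℕ := 4294967295

/-- Complement of a mask inside `full5`. -/
def cpl (X : ℕ) : ℕ := Nat.xor full5 (Nat.land X full5)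

/-- `⋃_{x ∈ F} f x` over the set bits `x` of `F`, lowest first, at most `fuel` of them (recursor form, as `allBits`). -/
noncomputable def foldOr (f : ℕ → ℕ) (fuel : ℕ) : ℕ → ℕ :=
  @Nat.rec (fun _ => ℕ → ℕ) (fun _ => 0)
    (fun _ ih F => @Bool.rec (fun _ => ℕ)
      (force (lowBit F) fun L => Nat.lor (f (Nat.log2 L)) (ih (Nat.xor F L))) 0 (Nat.beq F 0))
    fuel

/-- XOR-translate of a mask: `{x + t : x ∈ M}` on codes (`+` = `Nat.xor`). -/
noncomputable def xsh (M t : ℕ) : ℕ := foldOr (fun x => bit (Nat.xor x t)) M M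

/-- Mask of a list of codes. -/
def maskOf : List ℕ → ℕ
  | [] => 0
  | c :: cs => Nat.lor (bit c) (maskOf cs)

/-- PACKED TRANSLATE TABLE of a mask `P`: field `a` (32 bits at offset `32 a`, `a < 32`) is the mask of `P + a`. -/
noncomputable def packT (P : ℕ) : ℕ :=
  @Nat.rec (fun _ => ℕ) 0 (fun a acc => Nat.lor acc (Nat.shiftLeft (xsh P a) (Nat.mul 32 a))) 32

/-- Field `a` of a packed table. -/
def fld (T a : ℕ) : ℕ := Nat.land (Nat.shiftRight T (Nat.mul 32 a)) full5

/-- `⋃_{a ∈ used} (field a of T)`. -/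
noncomputable def spread (T used : ℕ) : ℕ := foldOr (fun a => fld T a) used used

/-- The tables of a `c`-code list: block `i` gets the packed translate table of `Pᵢ = cᵢ + C`. -/
noncomputable def mkTabs (C : List ℕ) : List ℕ := C.map fun c => packT (xsh (maskOf C) c)

/-- THE SEARCH. `go ts used F1`: place the blocks with tables `ts` (in order) in all ways compatible with the placed ones and answer whether
EVERY complete family has `F1 = full5`. Next block with table `T` (`P = fld T 0`): free codes `R = ∁(used ∪ F1)`; PRUNE (answer `true`)
if `R` has fewer than `2 · |ts|` codes; candidates `S = R ∖ ⋃_{a ∈ used} (P + a)`; pairs `a < a'` in `S` with `a + a' ∉ P`; child state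
`used ∪ {a, a'}`, `F1 ∪ (P + a) ∪ (P + a')`. -/
noncomputable def go : List ℕ → ℕ → ℕ → Bool :=
  @List.rec ℕ (fun _ => ℕ → ℕ → Bool)
    (fun _ F1 => Nat.beq F1 full5)
    (fun T ts ih used F1 =>
      force (cpl (Nat.lor used F1)) fun R =>
      !(hasBits (Nat.mul 2 (Nat.succ (List.length ts))) R) ||
      force (fld T 0) fun P =>
      force (Nat.land R (cpl (spread T used))) fun S =>
      allBits S (fun a =>
        force (Nat.land S (Nat.xor full5 (lowMask (Nat.add a 1)))) fun S2 =>
        force (Nat.lor F1 (fld T a)) fun F1a =>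
        force (Nat.lor used (bit a)) fun Ua =>
        allBits S2 (fun a2 =>
          Nat.testBit P (Nat.xor a a2) ||
          ih (Nat.lor Ua (bit a2)) (Nat.lor F1a (fld T a2)))
        S2)
      S)

end T1Z2p5

end Summit.MatrixMultiplication.OmegaCensus
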